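import Summits.Ventures.PercRepro.ProfilePointedCircuitClassesStarSevenFromSharpC

/-!
# PercRepro — (★) AT `(7, 4)` WITHOUT SPARE POINTS: TRANSPORT ALONG AN EMBEDDING
(p5, gen 57; `proofs/P5-GM1.md` §85 (g))

`starSeven_of_seriesExt` (g56) proves (★)₇ on a coloop-free rank-4 matroid `R` on seven points provided the type
carries two spare points outside `R.E`.  Mapping `R` along the embedding `a ↦ some (some a)` into `Option (Option α)`
supplies the spare points `none` and `some none`, and the bi-independent sets, the pointed counts and the ranks are
transported one to one (`Matroid.mapEmbedding`, `Matroid.eRk_map`): `starSeven` is (★)₇ on EVERY coloop-free rank-4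
matroid on seven points, with no hypothesis on the type.
-/

open scoped Matroid

namespace PercRepro.Cogirth

open Finset ThmH Skew Shadow Profile

open Classical

variable {α : Type} [DecidableEq α] {β : Type} [DecidableEq β] {R : Matroid α} [R.Finite]

section StarSevenMap

omit [DecidableEq α] [DecidableEq β] in
/-- The ground finset of the mapped matroid. -/
theorem gr_mapEmbedding (g : α ↪ β) : gr (R.mapEmbedding g) = (gr R).map g := by
  apply Finset.coe_injective
  rw [coe_gr, Matroid.mapEmbedding_ground_eq, coe_map, coe_gr]

omit [DecidableEq α] [DecidableEq β] in
/-- The rank of a mapped finset. -/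
theorem rk_mapEmbedding (g : α ↪ β) {X : Finset α} (hX : X ⊆ gr R) :
    rk (R.mapEmbedding g) (X.map g) = rk R X := by
  have hXE : (X : Set α) ⊆ R.E := by rw [← coe_gr]; exact_mod_cast hX
  have h : (R.mapEmbedding g).eRk (g '' (X : Set α)) = R.eRk X := Matroid.eRk_map R g.injective.injOn hXE
  have h1 := coe_rk (M := R.mapEmbedding g) (X.map g)
  have h2 := coe_rk (M := R) X
  rw [coe_map, h, ← h2] at h1
  exact_mod_cast h1

/-- Bi-independence is transported by the map. -/
theorem map_mem_biIndepSets_iff (g : α ↪ β) {k : ℕ} {X : Finset α} (hX : X ⊆ gr R) :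
    X.map g ∈ biIndepSets (R.mapEmbedding g) k ↔ X ∈ biIndepSets R k := by
  rw [mem_biIndepSets, mem_biIndepSets, gr_mapEmbedding, map_subset_map, card_map, rk_mapEmbedding g hX,
    ← Finset.map_sdiff, rk_mapEmbedding g sdiff_subset, card_map]

omit [DecidableEq α] in
/-- Every bi-independent set of the mapped matroid is the map of a subset of the ground set. -/
theorem exists_map_of_mem_biIndepSets (g : α ↪ β) {k : ℕ} {X' : Finset β}
    (hX' : X' ∈ biIndepSets (R.mapEmbedding g) k) : ∃ X ⊆ gr R, X' = X.map g := by
  have h := (mem_biIndepSets.1 hX').1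
  rw [gr_mapEmbedding] at h
  exact subset_map_iff.1 h

/-- Filtered counts of bi-independent sets are transported by the map. -/
theorem card_filter_biIndepSets_map (g : α ↪ β) (k : ℕ) (P : Finset β → Prop) (Q : Finset α → Prop)
    [DecidablePred P] [DecidablePred Q] (hPQ : ∀ X ⊆ gr R, (P (X.map g) ↔ Q X)) :
    ((biIndepSets (R.mapEmbedding g) k).filter P).card = ((biIndepSets R k).filter Q).card := by
  symm
  apply card_bij (fun X _ => X.map g)
  · intro X hX
    rw [mem_filter] at hX ⊢
    have hXg := (mem_biIndepSets.1 hX.1).1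
    exact ⟨(map_mem_biIndepSets_iff g hXg).2 hX.1, (hPQ X hXg).2 hX.2⟩
  · intro X _ X' _ h
    exact map_injective g h
  · intro X' hX'
    rw [mem_filter] at hX'
    obtain ⟨X, hXg, rfl⟩ := exists_map_of_mem_biIndepSets g hX'.1
    exact ⟨X, by rw [mem_filter]; exact ⟨(map_mem_biIndepSets_iff g hXg).1 hX'.1, (hPQ X hXg).1 hX'.2⟩, rfl⟩

/-- `in_k` is transported by the map. -/
theorem inCount_mapEmbedding (g : α ↪ β) (k : ℕ) (e : α) :
    inCount (R.mapEmbedding g) k (g e) = inCount R k e := by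
  unfold inCount
  exact card_filter_biIndepSets_map g k (fun W => g e ∈ W) (fun W => e ∈ W) (fun X _ => mem_map' g)

/-- `thru_k` is transported by the map. -/
theorem thruCount_mapEmbedding (g : α ↪ β) (k : ℕ) (S : Finset α) :
    thruCount (R.mapEmbedding g) k (S.map g) = thruCount R k S := by
  unfold thruCount
  exact card_filter_biIndepSets_map g k (fun W => S.map g ⊆ W) (fun W => S ⊆ W) (fun X _ => map_subset_map)

/-- The rank of the ground set minus a point is transported by the map. -/
theorem rk_erase_mapEmbedding (g : α ↪ β) (x : α) :
    rk (R.mapEmbedding g) ((gr (R.mapEmbedding g)).erase (g x)) = rk R ((gr R).erase x) := by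
  rw [gr_mapEmbedding, ← map_erase, rk_mapEmbedding g (erase_subset _ _)]

/-- **(★) AT `(7, 4)`**: on every coloop-free rank-4 matroid `R` on seven points, `in_3(e) ≤ in_3(f) + thru_3({e, f})`
for all `e ≠ f` — no spare points needed. -/
theorem starSeven (hn7 : (gr R).card = 7) (hR4 : rk R (gr R) = 4) (hcf7 : ∀ x ∈ gr R, rk R ((gr R).erase x) = 4)
    {e f : α} (he : e ∈ gr R) (hf : f ∈ gr R) (hef : e ≠ f) :
    inCount R 3 e ≤ inCount R 3 f + thruCount R 3 {e, f} := by
  let g : α ↪ Option (Option α) := Function.Embedding.some.trans Function.Embedding.some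
  have hg : ∀ a : α, g a = some (some a) := fun a => rfl
  have hdis : Disjoint (R.mapEmbedding g).E ({none, some none} : Set (Option (Option α))) := by
    rw [Set.disjoint_left]
    intro z hz hz'
    rw [Matroid.mapEmbedding_ground_eq] at hz
    obtain ⟨a, _, rfl⟩ := hz
    rw [hg] at hz'
    simp only [Set.mem_insert_iff, Set.mem_singleton_iff, reduceCtorEq, Option.some.injEq, or_self] at hz'
  have hn7' : (gr (R.mapEmbedding g)).card = 7 := by rw [gr_mapEmbedding, card_map, hn7]
  have hR4' : rk (R.mapEmbedding g) (gr (R.mapEmbedding g)) = 4 := by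
    rw [gr_mapEmbedding, rk_mapEmbedding g subset_rfl, hR4]
  have hcf7' : ∀ x ∈ gr (R.mapEmbedding g), rk (R.mapEmbedding g) ((gr (R.mapEmbedding g)).erase x) = 4 := by
    intro x hx
    rw [gr_mapEmbedding] at hx
    obtain ⟨a, ha, rfl⟩ := mem_map.1 hx
    rw [rk_erase_mapEmbedding, hcf7 a ha]
  have he' : g e ∈ gr (R.mapEmbedding g) := by rw [gr_mapEmbedding]; exact mem_map_of_mem g he
  have hf' : g f ∈ gr (R.mapEmbedding g) := by rw [gr_mapEmbedding]; exact mem_map_of_mem g hf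
  have hef' : g e ≠ g f := fun h => hef (g.injective h)
  have hbb' : (none : Option (Option α)) ≠ some none := by simp
  have h := starSeven_of_seriesExt hdis hn7' hR4' hcf7' hbb' he' hf' hef'
  have hpair : ({g e, g f} : Finset (Option (Option α))) = ({e, f} : Finset α).map g := by
    rw [map_insert, map_singleton]
  rw [inCount_mapEmbedding, inCount_mapEmbedding, hpair, thruCount_mapEmbedding] at h
  exact h

end StarSevenMap

end PercRepro.Cogirth
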